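import Summits.HodgeConjecture.CorCM.IrreducibleOddWeightsDichotomy
import Summits.HodgeConjecture.CorCM.IrreducibleOddWeightsCMFields
import HarnessLib

/-!
# The capacity dichotomy for CM fields: off (SC), more than `[K:ℚ]/4` pairwise non-isogenous simple abelian varieties
# with complex multiplication by `K` always carry an exceptional Hodge class

COR-CM (cell `pub-hodgecm2`, binder seat `b16` gen 55, count-neutral claim IRR-ODD, file F5b — the CM-field dress of F5
`CorCM/IrreducibleOddWeightsDichotomy`; theorems only, no definition, no named fact, no `sorry`).  NEW as stated, hence
under `Summits/`.  HONEST FRAMING: statements about families of CM types of ONE CM field `K` and products of abelian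
varieties with complex multiplication by `K`; `HC_CM` is neither used nor asserted — «exceptional classes for NAMED
classes» / «HC for NAMED classes».

(SC) for a CM field `K` of degree `2n` (seat gen 54): for all embeddings `x₀` and `x ∉ {x₀, x̄₀}` some `σ ∈ Aut(ℂ)` fixes
`x₀` and conjugates `x` (field test: `x₀(K) ⊄ x(K)·x₀(K⁺)`).  Gen 54 proved: under (SC) every CM type is nondegenerate,
every family of pairwise non-isogenous varieties with CM by `K` is additive iff its type vectors are linearly independent
— so ANY `≤ 3` of them satisfy the Hodge conjecture on all products with `B• = D•`, and up to `n` can.  THIS FILE is the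
other side, for EVERY CM field (no irreducibility hypothesis — F5 handles reducible odd weights by the equivariant
orthogonal projection, F1b irreducible ones by Schur):

* **`two_mul_card_le_of_not_stabConj`** — if (SC) FAILS, every nondegenerate family of CM types of `K` has
  `2|I| ≤ [K:ℚ]/2` (`card_le_finrank_div_four_of_not_stabConj`: at most `[K:ℚ]/4` members);
* **`stabConj_of_isNondegenerateFamily`** — contrapositive: a nondegenerate family of more than `[K:ℚ]/4` CM types of
  `K` (e.g. three pairwise non-isogenous CM abelian fourfolds with CM by one octic field and `Hg(A×B×C) =
  Hg(A)×Hg(B)×Hg(C)`) PROVES (SC) for `K` — and with it everything of gen 54;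
* **`exists_exceptional_prod_of_not_stabConj`** — (SC) fails, `A_i` SIMPLE, pairwise non-isogenous, with CM by `K`,
  more than `[K:ℚ]/4` of them ⟹ an exceptional Hodge class on some product `⨁_{j<N} A_{π j}`;
  `hodgeConjectureFor_prod_or_exists_exceptional_of_card_le_three` — THE DICHOTOMY for `≤ 3` (and `> [K:ℚ]/4`, i.e. `[K:ℚ] ≤ 10`… in
  general for `[K:ℚ]/4 < |I| ≤ 3`) pairwise non-isogenous simple varieties with CM by one field `K`: EITHER (SC) and the
  Hodge conjecture holds on all their products with `B• = D•`, OR not (SC) and some product carries an exceptional Hodge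
  class.

## References

* [Serre1977] J.-P. Serre, *Linear Representations of Finite Groups*, GTM 42 (1977), §1.3 Thm. 1, §2.2 Prop. 4.
* [Gordon1999HodgeAVSurvey] B. B. Gordon, *A survey of the Hodge conjecture for abelian varieties*, 7.5–7.7, 10.10.
* [Wielandt1964] H. Wielandt, *Finite Permutation Groups* (1964), Thm. 28.4.
* [Shimura1998] G. Shimura, *Abelian Varieties with Complex Multiplication and Modular Functions*, §8.2 Prop. 26.
-/

set_option autoImplicit false

noncomputable section

open CategoryTheory CategoryTheory.Limits NumberField

namespace Summit.HodgeConjecture.CorCM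

open Literature.NumberTheory.ComplexMultiplication
open Literature.AlgebraicGeometry.Motives (AbelianVariety CMType)
open Literature.AlgebraicGeometry.HodgeTheory
open Literature.AlgebraicGeometry.ComplexMultiplication (IsCMTypeRealisation)
open Literature.AlgebraicGeometry.VanGeemen1994 (hodgeClassSpan)
open Literature.AlgebraicGeometry.Pohlmann1968
open Literature.Barriers.HodgeConjecture (divisorClassesSpan)
open GenericCMField

variable {K : Type} [Field K] [NumberField K] [IsCMField K] {I : Type} [Fintype I] [DecidableEq I] [Nonempty I]

/-! ## §1 Off (SC): capacity at most `[K:ℚ]/4` -/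

section Capacity

/-- **OFF (SC), A NONDEGENERATE FAMILY OF CM TYPES OF `K` HAS `2|I| ≤ [K:ℚ]/2`** — for EVERY CM field `K` (irreducible
odd weights: the commutant has dimension `≥ 2`; reducible: two complementary equivariant projections).
[cite: Serre1977, §1.3 Thm. 1 and §2.2 Prop. 4] [cite: Gordon1999HodgeAVSurvey, 7.7] -/
theorem two_mul_card_le_of_not_stabConj
    (hnSC : ¬ ∀ x₀ x : K →+* ℂ, x ≠ x₀ → x ≠ (starRingAut : ℂ ≃+* ℂ) • x₀ →
      ∃ σ : ℂ ≃+* ℂ, σ • x₀ = x₀ ∧ σ • x = (starRingAut : ℂ ≃+* ℂ) • x)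
    {Φ : I → CMType K} (hΦ : CMAlgebra.IsNondegenerateFamily (K := fun _ : I => K) Φ) :
    2 * Fintype.card I ≤ Module.finrank ℚ K / 2 := by
  rw [isNondegenerateFamily_iff_typeRank_sigmaType_eq] at hΦ
  rw [← Embeddings.card K ℂ]
  exact IrrOdd.two_mul_card_le_of_not_multiplicityOne' (fun i => (Φ i).1) (fun i => isCMTypeWith_conj (Φ i))
    (not_multiplicityOne_of_not_stabConj hnSC) hΦ

/-- … i.e. **at most `[K:ℚ]/4` members**. [cite: Gordon1999HodgeAVSurvey, 7.7] -/
theorem card_le_finrank_div_four_of_not_stabConj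
    (hnSC : ¬ ∀ x₀ x : K →+* ℂ, x ≠ x₀ → x ≠ (starRingAut : ℂ ≃+* ℂ) • x₀ →
      ∃ σ : ℂ ≃+* ℂ, σ • x₀ = x₀ ∧ σ • x = (starRingAut : ℂ ≃+* ℂ) • x)
    {Φ : I → CMType K} (hΦ : CMAlgebra.IsNondegenerateFamily (K := fun _ : I => K) Φ) :
    Fintype.card I ≤ Module.finrank ℚ K / 4 := by
  have h := two_mul_card_le_of_not_stabConj hnSC hΦ
  omega

/-- **A nondegenerate family of more than `[K:ℚ]/4` CM types of `K` proves (SC) for `K`** (contrapositive) — and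
with (SC) every CM type of `K` is nondegenerate, every `≤ 3` pairwise non-isogenous varieties with CM by `K` are
additive, etc. (seat gen 54). [cite: Wielandt1964, Thm. 28.4] [cite: Gordon1999HodgeAVSurvey, 7.7] -/
theorem stabConj_of_isNondegenerateFamily {Φ : I → CMType K}
    (hΦ : CMAlgebra.IsNondegenerateFamily (K := fun _ : I => K) Φ) (hcard : Module.finrank ℚ K / 4 < Fintype.card I)
    (x₀ x : K →+* ℂ) (hx : x ≠ x₀) (hx' : x ≠ (starRingAut : ℂ ≃+* ℂ) • x₀) :
    ∃ σ : ℂ ≃+* ℂ, σ • x₀ = x₀ ∧ σ • x = (starRingAut : ℂ ≃+* ℂ) • x := by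
  by_contra hno
  have hnSC : ¬ ∀ x₀ x : K →+* ℂ, x ≠ x₀ → x ≠ (starRingAut : ℂ ≃+* ℂ) • x₀ →
      ∃ σ : ℂ ≃+* ℂ, σ • x₀ = x₀ ∧ σ • x = (starRingAut : ℂ ≃+* ℂ) • x := fun h => hno (h x₀ x hx hx')
  exact absurd (card_le_finrank_div_four_of_not_stabConj hnSC hΦ) (not_le.2 hcard)

end Capacity

/-! ## §2 Abelian varieties: exceptional classes beyond `[K:ℚ]/4`; the dichotomy -/

section Varieties

variable {Φ : I → CMType K} {A : I → AbelianVariety ℂ} {ι : ∀ i, 𝓞 K →+* End (A i)}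
  {θ : ∀ i, K →+* Module.End ℂ (complexBetti (A i).X 1)}

/-- **OFF (SC): MORE THAN `[K:ℚ]/4` PAIRWISE NON-ISOGENOUS SIMPLE ABELIAN VARIETIES WITH CM BY `K` CARRY AN EXCEPTIONAL
HODGE CLASS ON SOME PRODUCT `⨁_{j<N} A_{π j}`** — for EVERY CM field `K` failing (SC), e.g. any three simple CM abelian
fourfolds with CM by one octic CM field that is not (SC) (19 of the 38 octic Galois types; gen 54 census).  (The family
of types is separating but exceeds the capacity `[K:ℚ]/4`; if some type is degenerate the class already lives on a power
of that factor.) [cite: Gordon1999HodgeAVSurvey, 7.6.1 and 7.7] [cite: Serre1977, §1.3 Thm. 1 and §2.2 Prop. 4] -/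
theorem exists_exceptional_prod_of_not_stabConj
    (hnSC : ¬ ∀ x₀ x : K →+* ℂ, x ≠ x₀ → x ≠ (starRingAut : ℂ ≃+* ℂ) • x₀ →
      ∃ σ : ℂ ≃+* ℂ, σ • x₀ = x₀ ∧ σ • x = (starRingAut : ℂ ≃+* ℂ) • x)
    (hA : ∀ i, IsCMTypeRealisation (Φ i) (A i) (ι i) (θ i)) (hs : ∀ i, (A i).IsSimple)
    (hniso : ∀ i j, i ≠ j → ¬AbelianVariety.IsIsogenous (A i) (A j))
    (hcard : Module.finrank ℚ K / 4 < Fintype.card I) :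
    ∃ (N : ℕ) (π : Fin N → I) (m : ℕ) (c : complexBetti (⨁ fun j : Fin N => A (π j)).X (2 * m)),
      IsRationalClass c ∧
      IsOfHodgeType (⨁ fun j : Fin N => A (π j)).dim (⨁ fun j : Fin N => A (π j)).X (2 * m) m m c ∧
      c ∉ divisorClassesSpan (⨁ fun j : Fin N => A (π j)).X (⨁ fun j : Fin N => A (π j)).dim m :=
  CMAlgebra.exists_exceptional_prod_of_not_isNondegenerateFamily (K := fun _ : I => K)
    (CMAlgebra.isSeparatingFamily_of_isSimple_of_pairwise_not_isIsogenous hA hs hniso)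
    (fun hΦ => absurd (card_le_finrank_div_four_of_not_stabConj hnSC hΦ) (not_le.2 hcard)) hA

/-- **THE DICHOTOMY for `[K:ℚ]/4 < |I| ≤ 3` pairwise non-isogenous SIMPLE abelian varieties with CM by one CM field
`K`** (three simple CM fourfolds with one octic field; two or three simple CM threefolds with one sextic field; two or
three with one quartic or imaginary quadratic field): EITHER `K` is (SC) and the Hodge conjecture holds on every
product `⨁_{j<N} A_{π j}` with `B• = D•` (gen 54), OR `K` is not (SC) and some product carries an exceptional Hodge class.
[cite: Gordon1999HodgeAVSurvey, 7.5–7.7 and 10.10] [cite: Wielandt1964, Thm. 28.4] -/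
theorem hodgeConjectureFor_prod_or_exists_exceptional_of_card_le_three
    (hA : ∀ i, IsCMTypeRealisation (Φ i) (A i) (ι i) (θ i)) (hs : ∀ i, (A i).IsSimple)
    (hniso : ∀ i j, i ≠ j → ¬AbelianVariety.IsIsogenous (A i) (A j))
    (hcard : Module.finrank ℚ K / 4 < Fintype.card I) (h3 : Fintype.card I ≤ 3) :
    ((∀ x₀ x : K →+* ℂ, x ≠ x₀ → x ≠ (starRingAut : ℂ ≃+* ℂ) • x₀ →
        ∃ σ : ℂ ≃+* ℂ, σ • x₀ = x₀ ∧ σ • x = (starRingAut : ℂ ≃+* ℂ) • x) ∧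
      ∀ (N : ℕ) (π : Fin N → I),
        HodgeConjectureFor (⨁ fun j : Fin N => A (π j)).dim (⨁ fun j : Fin N => A (π j)).X ∧
        ∀ m : ℕ, hodgeClassSpan (⨁ fun j : Fin N => A (π j)).dim (⨁ fun j : Fin N => A (π j)).X m =
          divisorClassesSpan (⨁ fun j : Fin N => A (π j)).X (⨁ fun j : Fin N => A (π j)).dim m) ∨
    ((¬ ∀ x₀ x : K →+* ℂ, x ≠ x₀ → x ≠ (starRingAut : ℂ ≃+* ℂ) • x₀ →
        ∃ σ : ℂ ≃+* ℂ, σ • x₀ = x₀ ∧ σ • x = (starRingAut : ℂ ≃+* ℂ) • x) ∧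
      ∃ (N : ℕ) (π : Fin N → I) (m : ℕ) (c : complexBetti (⨁ fun j : Fin N => A (π j)).X (2 * m)),
        IsRationalClass c ∧
        IsOfHodgeType (⨁ fun j : Fin N => A (π j)).dim (⨁ fun j : Fin N => A (π j)).X (2 * m) m m c ∧
        c ∉ divisorClassesSpan (⨁ fun j : Fin N => A (π j)).X (⨁ fun j : Fin N => A (π j)).dim m) := by
  by_cases hSC : ∀ x₀ x : K →+* ℂ, x ≠ x₀ → x ≠ (starRingAut : ℂ ≃+* ℂ) • x₀ →
      ∃ σ : ℂ ≃+* ℂ, σ • x₀ = x₀ ∧ σ • x = (starRingAut : ℂ ≃+* ℂ) • x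
  · refine Or.inl ⟨hSC, fun N π => ?_⟩
    exact ⟨hodgeConjectureFor_prod_of_card_le_three_of_stabConj hSC hA hniso h3 π,
      fun m => hodgeClassSpan_prod_eq_of_card_le_three_of_stabConj hSC hA hniso h3 π m⟩
  · exact Or.inr ⟨hSC, exists_exceptional_prod_of_not_stabConj hSC hA hs hniso hcard⟩

/-- **Three pairwise non-isogenous SIMPLE CM abelian fourfolds with complex multiplication by one octic CM field `K`**:
the Hodge conjecture with `B• = D•` on all their products if `K` is (SC), an exceptional Hodge class on some product
otherwise — the two cases of `hodgeConjectureFor_prod_or_exists_exceptional_of_card_le_three` made explicit for `[K:ℚ] = 8`, `|I| = 3`.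
[cite: Gordon1999HodgeAVSurvey, 7.5–7.7 and 10.10] -/
theorem hodgeConjectureFor_prod_or_exists_exceptional_octic_three (h8 : Module.finrank ℚ K = 8)
    (hI : Fintype.card I = 3) (hA : ∀ i, IsCMTypeRealisation (Φ i) (A i) (ι i) (θ i)) (hs : ∀ i, (A i).IsSimple)
    (hniso : ∀ i j, i ≠ j → ¬AbelianVariety.IsIsogenous (A i) (A j)) :
    ((∀ x₀ x : K →+* ℂ, x ≠ x₀ → x ≠ (starRingAut : ℂ ≃+* ℂ) • x₀ →
        ∃ σ : ℂ ≃+* ℂ, σ • x₀ = x₀ ∧ σ • x = (starRingAut : ℂ ≃+* ℂ) • x) ∧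
      ∀ (N : ℕ) (π : Fin N → I),
        HodgeConjectureFor (⨁ fun j : Fin N => A (π j)).dim (⨁ fun j : Fin N => A (π j)).X ∧
        ∀ m : ℕ, hodgeClassSpan (⨁ fun j : Fin N => A (π j)).dim (⨁ fun j : Fin N => A (π j)).X m =
          divisorClassesSpan (⨁ fun j : Fin N => A (π j)).X (⨁ fun j : Fin N => A (π j)).dim m) ∨
    ((¬ ∀ x₀ x : K →+* ℂ, x ≠ x₀ → x ≠ (starRingAut : ℂ ≃+* ℂ) • x₀ →
        ∃ σ : ℂ ≃+* ℂ, σ • x₀ = x₀ ∧ σ • x = (starRingAut : ℂ ≃+* ℂ) • x) ∧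
      ∃ (N : ℕ) (π : Fin N → I) (m : ℕ) (c : complexBetti (⨁ fun j : Fin N => A (π j)).X (2 * m)),
        IsRationalClass c ∧
        IsOfHodgeType (⨁ fun j : Fin N => A (π j)).dim (⨁ fun j : Fin N => A (π j)).X (2 * m) m m c ∧
        c ∉ divisorClassesSpan (⨁ fun j : Fin N => A (π j)).X (⨁ fun j : Fin N => A (π j)).dim m) :=
  hodgeConjectureFor_prod_or_exists_exceptional_of_card_le_three hA hs hniso (by rw [h8, hI]; norm_num) (by rw [hI])

end Varieties

end Summit.HodgeConjecture.CorCM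

end
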